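import Summits.Ventures.CertifiedManyBodySolver.Theorems.M3x2EdgeSplitSymReplaySyntax

/-!
# SymReplay checker — Part A, first-order canonicaliser plumbing (`symCheckV`, additive to T1)

Additive companion of `Theorems.M3x2EdgeSplitSymReplaySyntax` (T1, Part A of the lb-sym word-form checker,
hub-lb-sym-plan-1 / hub-lb-sym-eng-3).  T1's executed canonicaliser binds
`corner := flatSite (minCorner K.frame)`; because a `def` returning `Site 2 = Fin 2 → ℤ` compiles at arity `+1`,
`minCorner`, `flatSite` and the sites of moved letters are partial applications re-evaluated at every coordinate
access on the compiled / IR path (`native_decide`, `#eval`) — `minCorner` then costs `2^|frame|` and a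
`useCanon := true` certificate does not terminate at any real frame (hub-lb-sym-ref-1 g0 «CANON-A RUNTIME rev 7»,
reproduced by the pen at `|frame| = 625`).  This module is sym-ref-1's PATCH V as folded into the crux workfile
`Cruxes/LowerEdge_ge_m83o100/Lines/symreplay.lean` rev 10 (commit 10d486743b73) by hub-lb-sym-plan-1: the SAME algorithm
(candidate set over `d4All`, `polyKeyLt` fold from the first candidate, `polyNegEq` sign-odd branch) with first-order
site data (`ℤ` values computed first, sites rebuilt from values), the executed checker `symCheckV`, and the PROVED
equalities `canonTermAV_eq` / `identityOKV_eq` / `symCheckV_eq : symCheckV K = symCheck K`, so every soundness statement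
about `symCheck` (T2–T11) transfers verbatim: a data file proves `symCheckV K = true` by `native_decide` and rewrites.
Nothing in T1 is changed (hub-lb-crit-1 V80 (B): additive module, no re-cut).  No summit statement is proved here;
nothing here predicts superconductivity.
-/

namespace Summit.Ventures.CertifiedManyBodySolver.Theorems.SymReplay

open Literature.Probability.LatticeModels (Site)

section SyntaxV

/-- A site from two computed integers. -/
def mkSite (a b : ℤ) : Site 2 := ![a, b]

/-- Componentwise minimum of a site list as a PAIR of integers (junk `(0,0)` on `[]`); `= (minCorner L 0, minCorner L 1)`
(`minCornerP_eq`). -/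
def minCornerP : List (Site 2) → ℤ × ℤ
  | [] => (0, 0)
  | [x] => (x 0, x 1)
  | x :: l => let m := minCornerP l; (min (x 0) m.1, min (x 1) m.2)

/-- Moved word with every letter site rebuilt from two computed integers (`= moveWordF`, `moveWordV_eq`). -/
def moveWordV (γ : DihedralGroup 4) (v : Site 2) (w : Word) : Word :=
  w.map fun ℓ => let y := moveSite γ v ℓ.x; let a := y 0; let b := y 1; ⟨mkSite a b, ℓ.s, ℓ.dag⟩

/-- `anchoredNFs` with first-order plumbing (`= anchoredNFs (mkSite cP.1 cP.2)`, `anchoredNFsV_eq`). -/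
def anchoredNFsV (cP : ℤ × ℤ) (frame : List (Site 2)) (u : Word) : List QPoly :=
  d4All.filterMap fun γ =>
    let m := minCornerP (wordSites (moveWordV γ 0 u))
    let a := cP.1 - m.1
    let b := cP.2 - m.2
    let w := moveWordV γ (mkSite a b) u
    if suppIn w frame then some (nfWord w) else none

/-- `canonA` with first-order plumbing (`= canonA (mkSite cP.1 cP.2)`, `canonAV_eq`). -/
def canonAV (cP : ℤ × ℤ) (frame : List (Site 2)) (u : Word) : QPoly :=
  match anchoredNFsV cP frame u with
  | [] => [(1, u)]
  | c :: cs =>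
    let best := cs.foldl (fun b c' => if polyKeyLt c' b then c' else b) c
    if (c :: cs).any (polyNegEq best) then [] else best

/-- `canonTermA` with first-order plumbing (`= canonTermA (mkSite cP.1 cP.2)`, `canonTermAV_eq`). -/
def canonTermAV (cP : ℤ × ℤ) (frame : List (Site 2)) (t : ℚ × Word) : QPoly := pscale t.1 (canonAV cP frame t.2)

/-- The identity test of T1 (`identityOK`) with the executed canonicaliser `canonTermAV (minCornerP K.frame)`;
`= identityOK K` (`identityOKV_eq`). -/
def identityOKV (K : SymCert) : Bool :=
  let N := collect (nfPoly (psub (lhsPoly K) (rhsPoly K)))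
  let cP := minCornerP K.frame
  isZero (if K.useCanon then N.flatMap (canonTermAV cP K.frame) else N)

/-- **The executed checker** — `wellFormed K && identityOKV K`; `= symCheck K` (`symCheckV_eq`).  Data files prove
`symCheckV K = true` by `native_decide` and conclude `symCheck K = true` by `symCheckV_eq`. -/
def symCheckV (K : SymCert) : Bool := wellFormed K && identityOKV K

/-! ### The executed canonicaliser equals the specification (rev-10 bridging lemmas, hub-lb-sym-plan-1) -/

/-- `moveWordV` is `moveWordF` (definitionally). -/
theorem moveWordV_eq : moveWordV = moveWordF := rfl

/-- The pair corner is the site corner read coordinatewise. -/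
theorem minCornerP_eq : ∀ L : List (Site 2), minCornerP L = (minCorner L 0, minCorner L 1)
  | [] => rfl
  | [x] => rfl
  | x :: y :: l => by
    show (min (x 0) (minCornerP (y :: l)).1, min (x 1) (minCornerP (y :: l)).2) =
      ((![min (x 0) (minCorner (y :: l) 0), min (x 1) (minCorner (y :: l) 1)] : Site 2) 0,
       (![min (x 0) (minCorner (y :: l) 0), min (x 1) (minCorner (y :: l) 1)] : Site 2) 1)
    rw [minCornerP_eq (y :: l)]
    rfl

/-- The first-order anchor vector is the specification's flattened anchor vector. -/
theorem mkSite_anchor_eq (cP : ℤ × ℤ) (L : List (Site 2)) :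
    mkSite (cP.1 - (minCornerP L).1) (cP.2 - (minCornerP L).2) = flatSite (mkSite cP.1 cP.2 - minCorner L) := by
  rw [minCornerP_eq]
  funext i
  fin_cases i <;> rfl

/-- `anchoredNFsV = anchoredNFs` at the corresponding corner. -/
theorem anchoredNFsV_eq (cP : ℤ × ℤ) (frame : List (Site 2)) (u : Word) :
    anchoredNFsV cP frame u = anchoredNFs (mkSite cP.1 cP.2) frame u := by
  unfold anchoredNFsV anchoredNFs
  congr 1
  funext γ
  simp only [moveWordV_eq, mkSite_anchor_eq]

/-- `canonAV = canonA` at the corresponding corner. -/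
theorem canonAV_eq (cP : ℤ × ℤ) (frame : List (Site 2)) (u : Word) :
    canonAV cP frame u = canonA (mkSite cP.1 cP.2) frame u := by
  unfold canonAV canonA
  rw [anchoredNFsV_eq]
  rfl

/-- `canonTermAV = canonTermA` at the corresponding corner. -/
theorem canonTermAV_eq (cP : ℤ × ℤ) (frame : List (Site 2)) :
    canonTermAV cP frame = canonTermA (mkSite cP.1 cP.2) frame := by
  funext t
  unfold canonTermAV canonTermA
  rw [canonAV_eq]

/-- The executed corner, as a site, is T1's `flatSite (minCorner frame)`. -/
theorem mkSite_minCornerP_eq (L : List (Site 2)) :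
    mkSite (minCornerP L).1 (minCornerP L).2 = flatSite (minCorner L) := by
  rw [minCornerP_eq]
  rfl

/-- **`identityOKV = identityOK`.** -/
theorem identityOKV_eq (K : SymCert) : identityOKV K = identityOK K := by
  unfold identityOKV identityOK
  simp only [canonTermAV_eq, mkSite_minCornerP_eq]

/-- **`symCheckV = symCheck`** — the executed checker decides exactly T1's checker. -/
theorem symCheckV_eq (K : SymCert) : symCheckV K = symCheck K := by
  unfold symCheckV symCheck
  rw [identityOKV_eq]

/-- Transfer lemma for data files: a `native_decide` run of the executed checker yields T1's `symCheck`. -/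
theorem symCheck_of_symCheckV (K : SymCert) (h : symCheckV K = true) : symCheck K = true := by
  rw [← symCheckV_eq]; exact h

/-- Kernel demo: the lever certificate of T1 (`useCanon := true`, frame `5 × 5`) passes the executed checker
in the kernel, like `toyCanonCert_check`. -/
example : symCheckV toyCanonCert = true := by decide +kernel

end SyntaxV

end Summit.Ventures.CertifiedManyBodySolver.Theorems.SymReplay
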